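import Literature.AnabelianGeometry.AbsoluteAnabelian.GaloisCyclotome
import Literature.NumberTheory.GaloisRepresentations.ContinuousCorestrictionTransfer
import Literature.NumberTheory.GaloisRepresentations.ContinuousCharactersAbelianization
import HarnessLib

/-!
# The Verlagerung `U^ab → V^ab` of [AbsTopIII] Cor. 1.10 (i)(a) induces the corestriction
# `H¹(V, A) → H¹(U, A)` on continuous duals

abc-iut cell, layer L4.  PROOF file (no definition, no named fact).  `GaloisCyclotome.lean` builds,
for open subgroups `V ≤ U` of a compact group `G`, the transfer
`transferToAbelianization : U → V^ab` and the Verlagerung `verlagerung : U^ab → V^ab` along which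
`μ_{ℚ/ℤ}(G) = lim_{→} (U^ab)_tors` is formed.  For a discrete abelian group `A` with trivial action, a
continuous character of `V^ab` is a continuous character `f` of `V` (`ContinuousCharactersAbelianization`),
i.e. a class of `H¹(V, A)`; the trunk's corestriction of `1`-cocycles along the open finite-index
subgroup `V ∩ U = V` of `U` (`cores`, `ContinuousCorestriction.lean`) is the group-theoretic transfer
on trivial coefficients (`ContinuousCorestrictionTransfer.lean`).  Hence:

* `map_transfer_eq_transfer_comp` — naturality of Mathlib's `MonoidHom.transfer` in the target:
  `ψ (Ver_φ g) = Ver_{ψ ∘ φ}(g)`;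
* `toMonoidHom_transferToAbelianization` — `ψ ∘ transferToAbelianization = transfer (ψ ∘ (V ∩ U → V^ab))`;
* **`cores_oneCocycleClass_eq_pullback_transferToAbelianization` —
  `cor_{V}^{U} [f] = [ψ ∘ transferToAbelianization]`** in `H¹(U, A)` for `ψ : V^ab → A` continuous with
  `f = ψ ∘ (V → V^ab)`; pointwise `…_apply_eq_verlagerung`: the corestricted character is
  `u ↦ ψ(verlagerung(ū))`.

So on continuous duals `Hom(·^ab, A) = H¹(·, A)` the Verlagerung of Cor. 1.10 (i)(a) IS the
corestriction (Serre, *Local Fields* VII §8; [AbsAnab] §1.2 p. 11 «by considering the Verlagerung»).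

HONEST FRAMING: classical; nothing here bears on [IUTchIII] Cor. 3.12 or takes a side.
-/

noncomputable section

open CategoryTheory Function

universe u

namespace Literature.AnabelianGeometry.AbsoluteAnabelian

open Literature.NumberTheory.GaloisRepresentations
open _root_.TopRep _root_.ContRepresentation _root_.ContinuousCohomology _root_.Topology

section TransferNaturality

variable {G : Type u} [Group G] {H : Subgroup G} [H.FiniteIndex]
variable {A B : Type*} [CommGroup A] [CommGroup B]

/-- **Naturality of the transfer in the target**: `ψ (Ver_φ(g)) = Ver_{ψ ∘ φ}(g)` for homomorphisms
`φ : H → A`, `ψ : A → B` of commutative groups. [cite: SerreLocalFields1979, VII §8] -/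
theorem map_transfer_eq_transfer_comp (φ : H →* A) (ψ : A →* B) (g : G) :
    ψ (MonoidHom.transfer φ g) = MonoidHom.transfer (ψ.comp φ) g := by
  rw [MonoidHom.transfer_def φ default g, MonoidHom.transfer_def (ψ.comp φ) default g]
  simp only [Subgroup.leftTransversals.diff, map_prod, MonoidHom.comp_apply]

end TransferNaturality

section Verlagerung

variable {G : Type u} [Group G] [TopologicalSpace G] [IsTopologicalGroup G] [CompactSpace G]
variable {U V : Subgroup G} (hU : IsOpen (U : Set G)) (hV : IsOpen (V : Set G)) (h : V ≤ U)
variable {A : Type u} [AddCommGroup A] [TopologicalSpace A] [DiscreteTopology A]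

/-- `ψ ∘ transferToAbelianization = transfer (ψ ∘ (V ∩ U → V^ab))` for any homomorphism `ψ` out of
`V^ab`. [cite: MochizukiAbsTopIII2015, Cor 1.10 (i) p.42] -/
theorem map_transferToAbelianization {B : Type*} [CommGroup B]
    (ψ : TopologicalAbelianization V →* B) (g : U) :
    ψ (transferToAbelianization hU hV h g) =
      (haveI := finiteIndex_subgroupOf hU hV
       MonoidHom.transfer (ψ.comp (toAbelianizationOfLe h)) g) := by
  haveI := finiteIndex_subgroupOf hU hV
  exact map_transfer_eq_transfer_comp _ ψ g

/-- **The Verlagerung induces the corestriction on continuous duals.**  Let `V ≤ U` be open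
subgroups of the compact group `G`, `A` a discrete abelian group (trivial action), `f` a continuous
character of `V` (a `1`-cocycle of the subgroup `V ∩ U` of `U`) and `ψ` the continuous character of
`V^ab` it factors through (`f = ψ ∘ (V → V^ab)`).  Then the corestriction `cor : H¹(V, A) → H¹(U, A)`
sends `[f]` to the class of the continuous character `ψ ∘ transferToAbelianization : U → V^ab → A`.
[cite: MochizukiAbsTopIII2015, Cor 1.10 (i) p.42] -/
theorem cores_oneCocycleClass_eq_pullback_transferToAbelianization [Fintype (U ⧸ V.subgroupOf U)]
    (f : contOneCocycles (subgroupRep (ContinuousRep.trivial U ℤ A).toTopRep (V.subgroupOf U)))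
    (ψ : contOneCocycles (ContinuousRep.trivial (TopologicalAbelianization V) ℤ A).toTopRep)
    (hfψ : ∀ v : V.subgroupOf U, f.1 v = ψ.1 (toAbelianizationOfLe h v)) :
    cores (ContinuousRep.trivial U ℤ A).toTopRep (V.subgroupOf U)
        (hV.preimage continuous_subtype_val) (oneCocycleClass _ f) =
      oneCocycleClass _ (contOneCocycles.pullback
        (⟨transferToAbelianization hU hV h, continuous_transferToAbelianization hU hV h⟩ :
          U →ₜ* TopologicalAbelianization V)
        (𝟙 ((ContinuousRep.trivial U ℤ A).toTopRep)) ψ) := by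
  -- the homomorphism `φ = ψ ∘ (V ∩ U → V^ab)` agreeing with `f`
  let φ : V.subgroupOf U →* Multiplicative A :=
    (contOneCocycles.toMonoidHomOfTrivial ψ).comp (toAbelianizationOfLe h)
  have hφ : ∀ n : V.subgroupOf U, φ n = Multiplicative.ofAdd (f.1 n) := fun n => by
    rw [hfψ n]; rfl
  refine cores_oneCocycleClass_eq_of_trivial _ _ (fun _ _ => rfl) _ f φ hφ _ fun g => ?_
  -- value of the pulled-back character at `g`: `ψ (transferToAbelianization g) = toAdd (Ver_φ g)`
  change ψ.1 (transferToAbelianization hU hV h g) = _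
  have hψ : ψ.1 (transferToAbelianization hU hV h g) =
      Multiplicative.toAdd (contOneCocycles.toMonoidHomOfTrivial ψ
        (transferToAbelianization hU hV h g)) := rfl
  rw [hψ, map_transferToAbelianization hU hV h]

/-- Pointwise: the corestricted character is `u ↦ ψ(verlagerung(ū))`, the Verlagerung
`U^ab → V^ab` of [AbsTopIII] Cor. 1.10 (i)(a) applied to the class of `u`.
[cite: MochizukiAbsTopIII2015, Cor 1.10 (i) p.42] -/
theorem pullback_transferToAbelianization_apply_eq_verlagerung
    (ψ : contOneCocycles (ContinuousRep.trivial (TopologicalAbelianization V) ℤ A).toTopRep)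
    (u : U) :
    (contOneCocycles.pullback
        (⟨transferToAbelianization hU hV h, continuous_transferToAbelianization hU hV h⟩ :
          U →ₜ* TopologicalAbelianization V)
        (𝟙 ((ContinuousRep.trivial U ℤ A).toTopRep)) ψ :
        contOneCocycles (ContinuousRep.trivial U ℤ A).toTopRep).1 u =
      ψ.1 (verlagerung hU hV h (QuotientGroup.mk u)) := by
  rw [verlagerung_mk]
  rfl

omit [CompactSpace G] in
/-- **Every continuous character of `V` arises from one of `V^ab`** compatible in the sense of
`cores_oneCocycleClass_eq_pullback_transferToAbelianization`: for `f` a `1`-cocycle of `V ∩ U ≤ U`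
(trivial coefficients) there is `ψ` on `V^ab` with `f = ψ ∘ (V ∩ U → V^ab)`.
[cite: MochizukiAbsTopIII2015, Cor 1.10 (i) p.42] -/
theorem exists_character_abelianization_eq
    (f : contOneCocycles (subgroupRep (ContinuousRep.trivial U ℤ A).toTopRep (V.subgroupOf U))) :
    ∃ ψ : contOneCocycles (ContinuousRep.trivial (TopologicalAbelianization V) ℤ A).toTopRep,
      ∀ v : V.subgroupOf U, f.1 v = ψ.1 (toAbelianizationOfLe h v) := by
  -- transport `f` to a continuous character of `V` along `V ∩ U ≃ V`, then descend to `V^ab`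
  let e := Subgroup.subgroupOfEquivOfLe h
  let fV : contOneCocycles (ContinuousRep.trivial V ℤ A).toTopRep :=
    ⟨⟨fun v => f.1 (e.symm v), f.1.continuous.comp (by
        exact Continuous.subtype_mk (Continuous.subtype_mk
          (continuous_subtype_val) _) _)⟩,
      fun a b => by
        change f.1 (e.symm (a * b)) = f.1 (e.symm a) + f.1 (e.symm b)
        rw [map_mul, subgroup_cocycle_mul]
        rfl⟩
  refine ⟨(contOneCocyclesAbelianizationEquiv V A).symm fV, fun v => ?_⟩
  change f.1 v = fV.1 (e v)
  change f.1 v = f.1 (e.symm (e v))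
  rw [MulEquiv.symm_apply_apply]

end Verlagerung

end Literature.AnabelianGeometry.AbsoluteAnabelian

end
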